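import Literature.NumberTheory.EllipticCurves.HalfIntegralWeightFormsProofs
import Mathlib.Analysis.Complex.Periodic
import Mathlib.Analysis.Analytic.IsolatedZeros
import HarnessLib

/-!
# Quantised decay at a cusp through a reference form (the "ratio lemma")

Analytic core of the inline proof of the Cohen–Oesterlé input of Tunnell's Theorem 2
(`S_{3/2}(128, χ₂) = span {g θ₁, g θ₄, g θ₁₆}`). To feed the Sturm-type criterion of
`HalfIntegralWeightSturm` one needs, at finitely many cusps `g∞`, LOWER BOUNDS for the order of
vanishing of a half-integral weight cusp form `H` that are sharper than "some positive order":
the order must lie in a prescribed arithmetic progression (the "class" of the multiplier system at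
that cusp, refined by an extra symmetry such as `z ↦ z + 1/8`). We obtain this without ever
evaluating a multiplier, by comparison with a REFERENCE function `G` having the same automorphy
at the cusp and a known expansion there:

**Theorem** (`slashSq_decay_of_ratio`). Let `H, G : ℍ → ℂ` be holomorphic, `g ∈ SL₂(ℤ)`, `w > 0`
and `θ ∈ ℝ` with
  `H(g(z + w)) · G(gz) = e^{2πiθ} · G(g(z + w)) · H(gz)`   for all `z`
(a common automorphy under the "parabolic" `z ↦ z + w` behind `g`, up to the phase `e^{2πiθ}`).
Suppose `|slashSq k G g| ≍ e^{-4π e Im z}` (two-sided, eventually) and `slashSq k H g → 0` at `i∞`.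
Then either `H = 0`, or there is an INTEGER `n` with `ρ := e + (θ + n)/w > 0` and
`slashSq k H g = O(e^{-4π ρ Im z})`.

(Recall `slashSq k F g (z) = F(gz)²/(cz + d)^k`, so `|slashSq| ≍ e^{-4πρ Im z}` means that `F` has
order `ρ` at the cusp `g∞` in the variable `e^{2πiz}`.) Proof: on `Im z ≫ 0` the reference does not
vanish, `M = H∘g / G∘g` satisfies `M(z + w) = e^{2πiθ} M(z)` and `|M|² = |slashSq H|/|slashSq G|
≤ C e^{4πe Im z}`; hence `F(ζ) = M(ζ) e^{2πi(m-θ)ζ/w}` (`m ∈ ℤ`, `m ≥ ew + θ`) is `w`-periodic,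
holomorphic and bounded at `i∞`, so by Mathlib's `Function.Periodic.cuspFunction` theory it is an
analytic function `Φ` of `q = e^{2πiζ/w}` near `q = 0`. If `Φ ≡ 0` near `0` then `H ≡ 0` (identity
theorem on `ℍ`, `UpperHalfPlane.eq_zero_of_frequently`). Otherwise `Φ(q) = q^{n₀} φ(q)`,
`φ(0) ≠ 0` (isolated zeros), which gives TWO-SIDED bounds `|M| ≍ e^{-2π(n₀-m+θ) Im z/w}` and hence
`|slashSq H| ≍ e^{-4πρ Im z}` with `n = n₀ - m`; as `slashSq H → 0`, `ρ > 0`.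

Also: `two_sided_of_tendsto` — the two-sided hypothesis on the reference from an explicit leading
term (`slashSq k G g = κ S²`, `S(z) e^{-2πiez} → s₀ ≠ 0`).

No statement of the tree is used unproved; no new named facts; no definitions.

## References

* G. Shimura, *On modular forms of half integral weight*, Ann. of Math. 97 (1973) 440–481, §1
  (expansions at the cusps of forms of half-integral weight). [Shimura1973HalfIntegral]
* J. B. Tunnell, *A classical Diophantine problem and modular forms of weight 3/2*, Invent. Math.
  72 (1983) 323–334, p. 327. [Tunnell1983Congruent]
-/

noncomputable section

open UpperHalfPlane hiding I
open Complex Filter Topology Asymptotics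
open scoped MatrixGroups Real Manifold

namespace Literature.NumberTheory.EllipticCurves.ModularForms

/-! ### Preliminaries -/

/-- `|slashSq k F g z| = |F(gz)|² / |cz+d|^k` with a positive denominator. [folklore] -/
theorem norm_denom_pow_pos (k : ℕ) (g : SL(2, ℤ)) (z : ℍ) : 0 < ‖denom (g : GL (Fin 2) ℝ) z‖ ^ k :=
  pow_pos (norm_pos_iff.mpr (denom_ne_zero _ z)) k

/-- **The ratio identity**: `|slashSq k H g| = |H(gz)/G(gz)|² · |slashSq k G g|` when `G(gz) ≠ 0`.
[folklore] -/
theorem norm_slashSq_eq_ratio_sq_mul (k : ℕ) {H G : ℍ → ℂ} (g : SL(2, ℤ)) (z : ℍ)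
    (hG : G (g • z) ≠ 0) :
    ‖slashSq k H g z‖ = ‖H (g • z) / G (g • z)‖ ^ 2 * ‖slashSq k G g z‖ := by
  rw [norm_slashSq, norm_slashSq, norm_div, div_pow]
  have hG' : ‖G (g • z)‖ ^ 2 ≠ 0 := pow_ne_zero _ (norm_ne_zero_iff.mpr hG)
  field_simp

/-- From an eventual statement at `i∞` on `ℍ` to a threshold `A` (restating `atImInfty_mem`).
[folklore] -/
theorem exists_forall_ge_of_eventually {p : ℍ → Prop} (h : ∀ᶠ z in atImInfty, p z) :
    ∃ A : ℝ, 0 < A ∧ ∀ z : ℍ, A ≤ z.im → p z := by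
  obtain ⟨A, hA⟩ := (atImInfty_mem _).mp h
  exact ⟨max A 1, by positivity, fun z hz ↦ hA z ((le_max_left _ _).trans hz)⟩

/-- `‖e^{2πi c ζ}‖ = e^{-2π c Im ζ}` for real `c`. [folklore] -/
theorem norm_cexp_two_pi_I_mul_real (c : ℝ) (ζ : ℂ) :
    ‖cexp (2 * π * I * c * ζ)‖ = Real.exp (-2 * π * c * ζ.im) := by
  rw [Complex.norm_exp]
  congr 1
  simp only [mul_re, mul_im, re_ofNat, im_ofNat, ofReal_re, ofReal_im, Complex.I_re, Complex.I_im]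
  ring

/-- `e^A = e^B` when `A - B = 2πi n`, `n ∈ ℤ` (restated from `HalfIntegralWeightGaussSums`). [folklore] -/
theorem cexp_eq_cexp_of_sub_eq' {A B : ℂ} (n : ℤ) (h : A - B = 2 * π * I * n) : cexp A = cexp B := by
  have : A = B + n * (2 * π * I) := by linear_combination h
  rw [this, Complex.exp_add, Complex.exp_int_mul_two_pi_mul_I, mul_one]

/-! ### Two-sided bounds for the reference from an explicit leading term -/

/-- **Two-sided size of the reference.** If `slashSq k G g = κ · S²` and
`S(z) e^{-2πi e z} → s₀ ≠ 0` at `i∞`, then eventually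
`(‖κ‖ ‖s₀‖²/4) e^{-4πe Im z} ≤ ‖slashSq k G g z‖ ≤ 4 ‖κ‖ ‖s₀‖² e^{-4πe Im z}`. [folklore] -/
theorem two_sided_of_tendsto {k : ℕ} {G S : ℍ → ℂ} {g : SL(2, ℤ)} {κ s₀ : ℂ} {e : ℝ}
    (hs₀ : s₀ ≠ 0) (hGS : ∀ z : ℍ, slashSq k G g z = κ * S z ^ 2)
    (hS : Tendsto (fun z : ℍ ↦ S z / cexp (2 * π * I * e * z)) atImInfty (𝓝 s₀)) :
    (∀ᶠ z in atImInfty, ‖κ‖ * ‖s₀‖ ^ 2 / 4 * Real.exp (-4 * π * e * z.im) ≤ ‖slashSq k G g z‖) ∧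
    (∀ᶠ z in atImInfty, ‖slashSq k G g z‖ ≤ 4 * ‖κ‖ * ‖s₀‖ ^ 2 * Real.exp (-4 * π * e * z.im)) := by
  have hs₀' : 0 < ‖s₀‖ := norm_pos_iff.mpr hs₀
  have hnear : ∀ᶠ z in atImInfty, ‖s₀‖ / 2 ≤ ‖S z / cexp (2 * π * I * e * z)‖ ∧
      ‖S z / cexp (2 * π * I * e * z)‖ ≤ 2 * ‖s₀‖ := by
    have h1 : ∀ᶠ z in atImInfty, dist (S z / cexp (2 * π * I * e * z)) s₀ < ‖s₀‖ / 2 :=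
      Metric.tendsto_nhds.mp hS _ (by positivity)
    filter_upwards [h1] with z hz
    rw [dist_eq_norm] at hz
    constructor
    · have := norm_sub_norm_le s₀ (S z / cexp (2 * π * I * e * z))
      rw [← norm_neg (s₀ - _), neg_sub] at this
      linarith
    · have := norm_le_insert' (S z / cexp (2 * π * I * e * z)) s₀
      linarith
  have hexp : ∀ z : ℍ, ‖cexp (2 * π * I * e * z)‖ = Real.exp (-2 * π * e * z.im) := fun z ↦ by
    rw [norm_cexp_two_pi_I_mul_real]; rfl
  have hexp_sq : ∀ z : ℍ, Real.exp (-2 * π * e * z.im) ^ 2 = Real.exp (-4 * π * e * z.im) :=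
    fun z ↦ by rw [← Real.exp_nat_mul]; congr 1; push_cast; ring
  have hnormS : ∀ z : ℍ, ‖S z‖ = ‖S z / cexp (2 * π * I * e * z)‖ * Real.exp (-2 * π * e * z.im) := by
    intro z
    rw [norm_div, hexp, div_mul_cancel₀ _ (Real.exp_pos _).ne']
  have hnormG : ∀ z : ℍ, ‖slashSq k G g z‖ = ‖κ‖ * ‖S z‖ ^ 2 := fun z ↦ by
    rw [hGS, norm_mul, norm_pow]
  constructor
  · filter_upwards [hnear] with z hz
    rw [hnormG, hnormS, mul_pow, hexp_sq]
    have hE := Real.exp_pos (-4 * π * e * z.im)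
    have h2 : (‖s₀‖ / 2) ^ 2 ≤ ‖S z / cexp (2 * π * I * e * z)‖ ^ 2 :=
      pow_le_pow_left₀ (by positivity) hz.1 2
    nlinarith [norm_nonneg κ, mul_nonneg (norm_nonneg κ) hE.le]
  · filter_upwards [hnear] with z hz
    rw [hnormG, hnormS, mul_pow, hexp_sq]
    have hE := Real.exp_pos (-4 * π * e * z.im)
    have h2 : ‖S z / cexp (2 * π * I * e * z)‖ ^ 2 ≤ (2 * ‖s₀‖) ^ 2 :=
      pow_le_pow_left₀ (norm_nonneg _) hz.2 2
    nlinarith [norm_nonneg κ, mul_nonneg (norm_nonneg κ) hE.le]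

/-! ### The ratio lemma -/

/-- **Quantised decay at a cusp through a reference** (see the module docstring).
[cite: Shimura1973HalfIntegral, §1] -/
theorem slashSq_decay_of_ratio {k : ℕ} {H G : ℍ → ℂ} (hH : MDiff H) (hG : MDiff G) (g : SL(2, ℤ))
    {w : ℝ} (hw : 0 < w) (θ : ℝ)
    (hrel : ∀ z : ℍ, H (g • ((w : ℝ) +ᵥ z)) * G (g • z) =
      cexp (2 * π * I * θ) * G (g • ((w : ℝ) +ᵥ z)) * H (g • z))
    {e β₁ β₂ : ℝ} (hβ₁ : 0 < β₁)
    (hGlow : ∀ᶠ z in atImInfty, β₁ * Real.exp (-4 * π * e * z.im) ≤ ‖slashSq k G g z‖)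
    (hGup : ∀ᶠ z in atImInfty, ‖slashSq k G g z‖ ≤ β₂ * Real.exp (-4 * π * e * z.im))
    (hH0 : IsZeroAtImInfty (slashSq k H g)) :
    H = 0 ∨ ∃ n : ℤ, 0 < e + (θ + n) / w ∧
      slashSq k H g =O[atImInfty] fun z ↦ Real.exp (-2 * π * (2 * (e + (θ + n) / w)) * z.im) := by
  -- the functions behind the cusp
  set A : ℍ → ℂ := fun z ↦ H (g • z) with hA_def
  set B : ℍ → ℂ := fun z ↦ G (g • z) with hB_def
  have hA : MDiff A := mdifferentiable_comp_smul hH g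
  have hB : MDiff B := mdifferentiable_comp_smul hG g
  set u : ℂ := cexp (2 * π * I * θ) with hu_def
  have hu0 : u ≠ 0 := Complex.exp_ne_zero _
  have hrel' : ∀ z : ℍ, A ((w : ℝ) +ᵥ z) * B z = u * B ((w : ℝ) +ᵥ z) * A z := fun z ↦ hrel z
  /- Step 1: a threshold beyond which everything holds -/
  have hH1 : ∀ᶠ z in atImInfty, ‖slashSq k H g z‖ ≤ 1 := by
    obtain ⟨A₀, hA₀⟩ := (isZeroAtImInfty_iff.mp hH0) 1 one_pos
    exact (atImInfty_mem _).mpr ⟨A₀, hA₀⟩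
  obtain ⟨Y, hY0, hY⟩ := exists_forall_ge_of_eventually (hGlow.and (hGup.and hH1))
  have hBne : ∀ z : ℍ, Y ≤ z.im → B z ≠ 0 := by
    intro z hz h0
    have h1 := (hY z hz).1
    have : slashSq k G g z = 0 := by
      have h0' : G (g • z) = 0 := h0
      rw [slashSq, h0', zero_pow two_ne_zero, zero_div]
    rw [this, norm_zero] at h1
    linarith [mul_pos hβ₁ (Real.exp_pos (-4 * π * e * z.im))]
  /- Step 2: the ratio `M` -/
  set M : ℍ → ℂ := fun z ↦ A z / B z with hM_def
  have hMrel : ∀ z : ℍ, Y ≤ z.im → M ((w : ℝ) +ᵥ z) = u * M z := by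
    intro z hz
    have hz' : Y ≤ ((w : ℝ) +ᵥ z).im := by rwa [vadd_im]
    have h1 := hBne z hz
    have h2 := hBne _ hz'
    have h3 := hrel' z
    simp only [hM_def]
    field_simp
    linear_combination h3
  have hsq : ∀ z : ℍ, Y ≤ z.im → ‖slashSq k H g z‖ = ‖M z‖ ^ 2 * ‖slashSq k G g z‖ :=
    fun z hz ↦ norm_slashSq_eq_ratio_sq_mul k g z (hBne z hz)
  have hM2 : ∀ z : ℍ, Y ≤ z.im → ‖M z‖ ^ 2 ≤ β₁⁻¹ * Real.exp (4 * π * e * z.im) := by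
    intro z hz
    obtain ⟨hlow, -, hone⟩ := hY z hz
    have hE := Real.exp_pos (-4 * π * e * z.im)
    have hG0 : 0 < ‖slashSq k G g z‖ := lt_of_lt_of_le (mul_pos hβ₁ hE) hlow
    have h1 : ‖M z‖ ^ 2 ≤ 1 / ‖slashSq k G g z‖ := by
      rw [le_div_iff₀ hG0, ← hsq z hz]; exact hone
    have h2 : 1 / ‖slashSq k G g z‖ ≤ 1 / (β₁ * Real.exp (-4 * π * e * z.im)) :=
      one_div_le_one_div_of_le (mul_pos hβ₁ hE) hlow
    have h3 : 1 / (β₁ * Real.exp (-4 * π * e * z.im)) = β₁⁻¹ * Real.exp (4 * π * e * z.im) := by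
      rw [show (4 * π * e * z.im : ℝ) = -(-4 * π * e * z.im) by ring, Real.exp_neg]
      field_simp
    linarith [h3 ▸ h2]
  have hM1 : ∀ z : ℍ, Y ≤ z.im → ‖M z‖ ≤ Real.sqrt β₁⁻¹ * Real.exp (2 * π * e * z.im) := by
    intro z hz
    have h := hM2 z hz
    have he2 : Real.exp (4 * π * e * z.im) = Real.exp (2 * π * e * z.im) ^ 2 := by
      rw [← Real.exp_nat_mul]; congr 1; push_cast; ring
    rw [he2, show β₁⁻¹ * Real.exp (2 * π * e * z.im) ^ 2 =
      (Real.sqrt β₁⁻¹ * Real.exp (2 * π * e * z.im)) ^ 2 by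
        rw [mul_pow, Real.sq_sqrt (inv_nonneg.mpr hβ₁.le)]] at h
    exact (pow_le_pow_iff_left₀ (norm_nonneg _) (by positivity) two_ne_zero).mp h
  /- Step 3: the periodic bounded holomorphic function `F` on `ℂ` -/
  set m : ℤ := ⌈e * w + θ⌉ with hm_def
  have hm : e * w + θ ≤ m := Int.le_ceil _
  set c : ℝ := (m - θ) / w with hc_def
  have hcw : c * w = m - θ := by rw [hc_def]; field_simp
  have hce : e ≤ c := by
    rw [hc_def, le_div_iff₀ hw]; linarith
  set F : ℂ → ℂ := fun ζ ↦ if Y < ζ.im then M (ofComplex ζ) * cexp (2 * π * I * c * ζ) else 0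
    with hF_def
  have hF_of : ∀ ζ : ℂ, Y < ζ.im → F ζ = M (ofComplex ζ) * cexp (2 * π * I * c * ζ) :=
    fun ζ hζ ↦ by simp only [hF_def, if_pos hζ]
  have him_of : ∀ ζ : ℂ, Y < ζ.im → (ofComplex ζ).im = ζ.im := fun ζ hζ ↦ by
    rw [ofComplex_apply_of_im_pos (hY0.trans hζ)]; rfl
  have hcoe_of : ∀ ζ : ℂ, Y < ζ.im → ((ofComplex ζ : ℍ) : ℂ) = ζ := fun ζ hζ ↦ by
    rw [ofComplex_apply_of_im_pos (hY0.trans hζ)]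
  -- the phase over a period
  have hexp_cw : cexp (2 * π * I * c * w) = u⁻¹ := by
    rw [hu_def, ← Complex.exp_neg]
    refine cexp_eq_cexp_of_sub_eq' m ?_
    have : (c : ℂ) * w = m - θ := by exact_mod_cast hcw
    linear_combination (2 * π * I) * this
  -- periodicity
  have hper : Function.Periodic F w := by
    intro ζ
    have him : (ζ + (w : ℂ)).im = ζ.im := by simp
    by_cases hζ : Y < ζ.im
    · have hζ' : Y < (ζ + (w : ℂ)).im := by rwa [him]
      rw [hF_of _ hζ', hF_of _ hζ]
      have hpt : ofComplex (ζ + (w : ℂ)) = (w : ℝ) +ᵥ ofComplex ζ := by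
        apply UpperHalfPlane.ext
        rw [hcoe_of _ hζ', coe_vadd, hcoe_of _ hζ]
        ring
      rw [hpt, hMrel _ (by rw [him_of _ hζ]; exact hζ.le), mul_add, Complex.exp_add, hexp_cw]
      field_simp
    · have hζ' : ¬ Y < (ζ + (w : ℂ)).im := by rwa [him]
      simp only [hF_def, if_neg hζ, if_neg hζ']
  -- holomorphy near `i∞`
  have hopen : IsOpen {ζ : ℂ | Y < ζ.im} := isOpen_lt continuous_const Complex.continuous_im
  have hdiffM : ∀ ζ : ℂ, Y < ζ.im → DifferentiableAt ℂ (fun ζ ↦ M (ofComplex ζ)) ζ := by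
    intro ζ hζ
    have hAd : DifferentiableAt ℂ (A ∘ ofComplex) ζ := by
      have := UpperHalfPlane.mdifferentiableAt_iff.mp (hA (ofComplex ζ))
      rwa [hcoe_of _ hζ] at this
    have hBd : DifferentiableAt ℂ (B ∘ ofComplex) ζ := by
      have := UpperHalfPlane.mdifferentiableAt_iff.mp (hB (ofComplex ζ))
      rwa [hcoe_of _ hζ] at this
    have hB0 : (B ∘ ofComplex) ζ ≠ 0 := hBne _ (by rw [him_of _ hζ]; exact hζ.le)
    exact hAd.div hBd hB0
  have hdiffF : ∀ ζ : ℂ, Y < ζ.im → DifferentiableAt ℂ F ζ := by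
    intro ζ hζ
    have heq : F =ᶠ[𝓝 ζ] fun ζ ↦ M (ofComplex ζ) * cexp (2 * π * I * c * ζ) := by
      filter_upwards [hopen.mem_nhds hζ] with ζ' hζ'
      exact hF_of _ hζ'
    refine DifferentiableAt.congr_of_eventuallyEq ?_ heq
    exact (hdiffM ζ hζ).mul ((differentiableAt_id.const_mul _).cexp)
  have hhol : ∀ᶠ ζ in comap Complex.im atTop, DifferentiableAt ℂ F ζ := by
    filter_upwards [preimage_mem_comap (Ioi_mem_atTop Y)] with ζ hζ
    exact hdiffF ζ hζ
  -- boundedness at `i∞`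
  have hnormF : ∀ ζ : ℂ, Y < ζ.im → ‖F ζ‖ = ‖M (ofComplex ζ)‖ * Real.exp (-2 * π * c * ζ.im) := by
    intro ζ hζ
    rw [hF_of _ hζ, norm_mul, norm_cexp_two_pi_I_mul_real]
  have hbddF : ∀ ζ : ℂ, Y < ζ.im → ‖F ζ‖ ≤ Real.sqrt β₁⁻¹ := by
    intro ζ hζ
    rw [hnormF _ hζ]
    have h1 := hM1 (ofComplex ζ) (by rw [him_of _ hζ]; exact hζ.le)
    rw [him_of _ hζ] at h1
    have hE := Real.exp_pos (-2 * π * c * ζ.im)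
    calc ‖M (ofComplex ζ)‖ * Real.exp (-2 * π * c * ζ.im)
        ≤ Real.sqrt β₁⁻¹ * Real.exp (2 * π * e * ζ.im) * Real.exp (-2 * π * c * ζ.im) :=
          mul_le_mul_of_nonneg_right h1 hE.le
      _ = Real.sqrt β₁⁻¹ * Real.exp (2 * π * (e - c) * ζ.im) := by
          rw [mul_assoc, ← Real.exp_add]; congr 2; ring
      _ ≤ Real.sqrt β₁⁻¹ * 1 := by
          refine mul_le_mul_of_nonneg_left ?_ (Real.sqrt_nonneg _)
          rw [Real.exp_le_one_iff]
          have him0 : 0 ≤ ζ.im := (hY0.trans hζ).le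
          have h2 : 2 * π * (e - c) ≤ 0 :=
            mul_nonpos_of_nonneg_of_nonpos (by positivity) (by linarith)
          exact mul_nonpos_of_nonpos_of_nonneg h2 him0
      _ = Real.sqrt β₁⁻¹ := mul_one _
  have hbdd : BoundedAtFilter (comap Complex.im atTop) F := by
    rw [BoundedAtFilter, Asymptotics.isBigO_iff]
    refine ⟨Real.sqrt β₁⁻¹, ?_⟩
    filter_upwards [preimage_mem_comap (Ioi_mem_atTop Y)] with ζ hζ
    simpa using hbddF ζ hζ
  /- Step 4: the cusp function is analytic at `0` -/
  set Φ := Function.Periodic.cuspFunction w F with hΦ_def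
  have hΦ0 : DifferentiableAt ℂ Φ 0 :=
    Function.Periodic.differentiableAt_cuspFunction_zero hw hper hhol hbdd
  have hΦne : ∀ᶠ q in 𝓝[≠] (0 : ℂ), DifferentiableAt ℂ Φ q :=
    Function.Periodic.eventually_differentiableAt_cuspFunction_nhds_ne_zero hw hper hhol
  have hΦan : AnalyticAt ℂ Φ 0 := by
    rw [analyticAt_iff_eventually_differentiableAt]
    have h1 := eventually_nhdsWithin_iff.mp hΦne
    filter_upwards [h1] with q hq
    by_cases hq0 : q = 0
    · rw [hq0]; exact hΦ0
    · exact hq hq0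
  have hΦF : ∀ ζ : ℂ, Φ (Function.Periodic.qParam w ζ) = F ζ :=
    Function.Periodic.eq_cuspFunction hw.ne' hper
  -- transfer from `𝓝 0` to `atImInfty` on `ℍ`
  have htend : Tendsto (fun z : ℍ ↦ Function.Periodic.qParam w (z : ℂ)) atImInfty (𝓝 0) :=
    ((Function.Periodic.qParam_tendsto hw).mono_right nhdsWithin_le_nhds).comp
      tendsto_coe_atImInfty
  have hFz : ∀ z : ℍ, Y < z.im → F (z : ℂ) = M z * cexp (2 * π * I * c * z) := by
    intro z hz
    rw [hF_of _ (by simpa using hz), ofComplex_apply]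
  have hnormq : ∀ (z : ℍ) (n : ℕ), ‖Function.Periodic.qParam w (z : ℂ)‖ ^ n =
      Real.exp (-2 * π * n * z.im / w) := by
    intro z n
    rw [Function.Periodic.norm_qParam, ← Real.exp_nat_mul, UpperHalfPlane.coe_im]
    congr 1; ring
  /- Step 5: the dichotomy -/
  rcases hΦan.eventually_eq_zero_or_eventually_ne_zero with hzero | hnz
  · -- `Φ ≡ 0` near `0`: then `H = 0`
    left
    have h1 : ∀ᶠ z : ℍ in atImInfty, F (z : ℂ) = 0 := by
      have := htend.eventually hzero
      filter_upwards [this] with z hz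
      rwa [hΦF] at hz
    have h2 : ∀ᶠ z in atImInfty, Y < z.im := by
      refine (atImInfty_mem _).mpr ⟨Y + 1, fun z hz ↦ ?_⟩
      simp only [Set.mem_setOf_eq]; linarith
    obtain ⟨Y', hY'0, hY'⟩ := exists_forall_ge_of_eventually (h1.and h2)
    have hA0 : ∀ z : ℍ, Y' ≤ z.im → A z = 0 := by
      intro z hz
      obtain ⟨hF0, hzY⟩ := hY' z hz
      rw [hFz z hzY, mul_eq_zero] at hF0
      rcases hF0 with hM0 | hexp0
      · have : A z = M z * B z := by
          simp only [hM_def]; rw [div_mul_cancel₀ _ (hBne z hzY.le)]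
        rw [this, hM0, zero_mul]
      · exact absurd hexp0 (Complex.exp_ne_zero _)
    -- identity theorem
    set τ : ℍ := ⟨⟨0, Y' + 1⟩, by change 0 < Y' + 1; linarith⟩ with hτ
    have hτim : τ.im = Y' + 1 := rfl
    have hAzero : A = 0 := by
      refine UpperHalfPlane.eq_zero_of_frequently hA (τ := τ) ?_
      have hev : ∀ᶠ z in 𝓝 τ, A z = 0 := by
        have hopen' : IsOpen {z : ℍ | Y' < z.im} := isOpen_lt continuous_const UpperHalfPlane.continuous_im
        filter_upwards [hopen'.mem_nhds (show Y' < τ.im by rw [hτim]; linarith)] with z hz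
        exact hA0 z (le_of_lt hz)
      exact (hev.filter_mono nhdsWithin_le_nhds).frequently
    funext y
    have := congrFun hAzero (g⁻¹ • y)
    simpa [hA_def] using this
  · -- `Φ(q) = q^{n₀} φ(q)`, `φ(0) ≠ 0`
    right
    have hnot : ¬ ∀ᶠ q in 𝓝 (0 : ℂ), Φ q = 0 := by
      intro h
      have := (h.filter_mono nhdsWithin_le_nhds).and hnz
      exact (this.exists).elim fun q hq ↦ hq.2 hq.1
    obtain ⟨n₀, φ, hφan, hφ0, hΦeq⟩ := hΦan.exists_eventuallyEq_pow_smul_nonzero_iff.mpr hnot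
    have hφ0' : 0 < ‖φ 0‖ := norm_pos_iff.mpr hφ0
    -- two-sided bounds for `Φ` near `0`
    have hφnear : ∀ᶠ q in 𝓝 (0 : ℂ), ‖φ 0‖ / 2 ≤ ‖φ q‖ ∧ ‖φ q‖ ≤ 2 * ‖φ 0‖ := by
      have h1 : ∀ᶠ q in 𝓝 (0 : ℂ), dist (φ q) (φ 0) < ‖φ 0‖ / 2 :=
        Metric.tendsto_nhds.mp hφan.continuousAt.tendsto _ (by positivity)
      filter_upwards [h1] with q hq
      rw [dist_eq_norm] at hq
      constructor
      · have := norm_sub_norm_le (φ 0) (φ q)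
        rw [← norm_neg (φ 0 - _), neg_sub] at this
        linarith
      · have := norm_le_insert' (φ q) (φ 0)
        linarith
    have hΦbounds : ∀ᶠ q in 𝓝 (0 : ℂ), ‖φ 0‖ / 2 * ‖q‖ ^ n₀ ≤ ‖Φ q‖ ∧
        ‖Φ q‖ ≤ 2 * ‖φ 0‖ * ‖q‖ ^ n₀ := by
      filter_upwards [hφnear, hΦeq] with q hq hΦq
      rw [hΦq, sub_zero, smul_eq_mul, norm_mul, norm_pow]
      constructor
      · nlinarith [hq.1, pow_nonneg (norm_nonneg q) n₀]
      · nlinarith [hq.2, pow_nonneg (norm_nonneg q) n₀]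
    -- transfer to `ℍ`
    set n : ℤ := (n₀ : ℤ) - m with hn_def
    set ρ : ℝ := e + (θ + n) / w with hρ_def
    have h2 : ∀ᶠ z in atImInfty, Y < z.im := by
      refine (atImInfty_mem _).mpr ⟨Y + 1, fun z hz ↦ ?_⟩
      simp only [Set.mem_setOf_eq]; linarith
    have hkeyexp : ∀ z : ℍ, Real.exp (-2 * π * n₀ * z.im / w) * Real.exp (2 * π * c * z.im) =
        Real.exp (-2 * π * ((θ + n) / w) * z.im) := by
      intro z
      rw [← Real.exp_add]
      congr 1
      have hw0 : w ≠ 0 := hw.ne'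
      rw [hn_def, hc_def]
      push_cast
      field_simp
      ring
    have hMbounds : ∀ᶠ z in atImInfty,
        ‖φ 0‖ / 2 * Real.exp (-2 * π * ((θ + n) / w) * z.im) ≤ ‖M z‖ ∧
        ‖M z‖ ≤ 2 * ‖φ 0‖ * Real.exp (-2 * π * ((θ + n) / w) * z.im) := by
      filter_upwards [htend.eventually hΦbounds, h2] with z hz hzY
      have hq : ‖Function.Periodic.qParam w (z : ℂ)‖ ^ n₀ = Real.exp (-2 * π * n₀ * z.im / w) :=
        hnormq z n₀
      have hΦz : ‖Φ (Function.Periodic.qParam w (z : ℂ))‖ = ‖M z‖ * Real.exp (-2 * π * c * z.im) := by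
        rw [hΦF, hFz z hzY, norm_mul, norm_cexp_two_pi_I_mul_real, UpperHalfPlane.coe_im]
      rw [hq, hΦz] at hz
      have hE := Real.exp_pos (2 * π * c * z.im)
      have hE' : Real.exp (-2 * π * c * z.im) * Real.exp (2 * π * c * z.im) = 1 := by
        rw [← Real.exp_add]; convert Real.exp_zero using 2; ring
      constructor
      · calc ‖φ 0‖ / 2 * Real.exp (-2 * π * ((θ + n) / w) * z.im)
            = ‖φ 0‖ / 2 * Real.exp (-2 * π * n₀ * z.im / w) * Real.exp (2 * π * c * z.im) := by
              rw [← hkeyexp z]; ring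
          _ ≤ ‖M z‖ * Real.exp (-2 * π * c * z.im) * Real.exp (2 * π * c * z.im) :=
              mul_le_mul_of_nonneg_right hz.1 hE.le
          _ = ‖M z‖ := by rw [mul_assoc ‖M z‖, hE', mul_one]
      · calc ‖M z‖ = ‖M z‖ * Real.exp (-2 * π * c * z.im) * Real.exp (2 * π * c * z.im) := by
              rw [mul_assoc ‖M z‖, hE', mul_one]
          _ ≤ 2 * ‖φ 0‖ * Real.exp (-2 * π * n₀ * z.im / w) * Real.exp (2 * π * c * z.im) :=
              mul_le_mul_of_nonneg_right hz.2 hE.le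
          _ = 2 * ‖φ 0‖ * Real.exp (-2 * π * ((θ + n) / w) * z.im) := by
              rw [← hkeyexp z]; ring
    have hexp2 : ∀ z : ℍ, Real.exp (-2 * π * ((θ + n) / w) * z.im) ^ 2 *
        Real.exp (-4 * π * e * z.im) = Real.exp (-2 * π * (2 * ρ) * z.im) := by
      intro z
      rw [← Real.exp_nat_mul, ← Real.exp_add]
      congr 1
      rw [hρ_def]; push_cast; ring
    -- the upper bound
    have hup : ∀ᶠ z in atImInfty, ‖slashSq k H g z‖ ≤
        (2 * ‖φ 0‖) ^ 2 * β₂ * Real.exp (-2 * π * (2 * ρ) * z.im) := by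
      filter_upwards [hMbounds, h2, hGup] with z hz hzY hGz
      rw [hsq z hzY.le, ← hexp2]
      have h1 : ‖M z‖ ^ 2 ≤ (2 * ‖φ 0‖) ^ 2 * Real.exp (-2 * π * ((θ + n) / w) * z.im) ^ 2 := by
        rw [← mul_pow]; exact pow_le_pow_left₀ (norm_nonneg _) hz.2 2
      have h0 : 0 ≤ ‖slashSq k G g z‖ := norm_nonneg _
      calc ‖M z‖ ^ 2 * ‖slashSq k G g z‖
          ≤ (2 * ‖φ 0‖) ^ 2 * Real.exp (-2 * π * ((θ + n) / w) * z.im) ^ 2 * ‖slashSq k G g z‖ :=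
            mul_le_mul_of_nonneg_right h1 h0
        _ ≤ (2 * ‖φ 0‖) ^ 2 * Real.exp (-2 * π * ((θ + n) / w) * z.im) ^ 2 *
              (β₂ * Real.exp (-4 * π * e * z.im)) :=
            mul_le_mul_of_nonneg_left hGz (by positivity)
        _ = (2 * ‖φ 0‖) ^ 2 * β₂ * (Real.exp (-2 * π * ((θ + n) / w) * z.im) ^ 2 *
              Real.exp (-4 * π * e * z.im)) := by ring
    -- the lower bound and positivity of `ρ`
    have hlow : ∀ᶠ z in atImInfty, (‖φ 0‖ / 2) ^ 2 * β₁ * Real.exp (-2 * π * (2 * ρ) * z.im) ≤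
        ‖slashSq k H g z‖ := by
      filter_upwards [hMbounds, h2, hGlow] with z hz hzY hGz
      rw [hsq z hzY.le, ← hexp2]
      have h1 : (‖φ 0‖ / 2) ^ 2 * Real.exp (-2 * π * ((θ + n) / w) * z.im) ^ 2 ≤ ‖M z‖ ^ 2 := by
        rw [← mul_pow]; exact pow_le_pow_left₀ (by positivity) hz.1 2
      have hE := Real.exp_pos (-4 * π * e * z.im)
      calc (‖φ 0‖ / 2) ^ 2 * β₁ * (Real.exp (-2 * π * ((θ + n) / w) * z.im) ^ 2 *
            Real.exp (-4 * π * e * z.im))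
          = (‖φ 0‖ / 2) ^ 2 * Real.exp (-2 * π * ((θ + n) / w) * z.im) ^ 2 *
              (β₁ * Real.exp (-4 * π * e * z.im)) := by ring
        _ ≤ ‖M z‖ ^ 2 * (β₁ * Real.exp (-4 * π * e * z.im)) :=
            mul_le_mul_of_nonneg_right h1 (by positivity)
        _ ≤ ‖M z‖ ^ 2 * ‖slashSq k G g z‖ := mul_le_mul_of_nonneg_left hGz (by positivity)
    have hρ : 0 < ρ := by
      by_contra hρ
      push Not at hρ
      set ε₀ : ℝ := (‖φ 0‖ / 2) ^ 2 * β₁ with hε₀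
      have hε₀pos : 0 < ε₀ := by positivity
      have hsmall : ∀ᶠ z in atImInfty, ‖slashSq k H g z‖ ≤ ε₀ / 2 := by
        obtain ⟨A₀, hA₀⟩ := (isZeroAtImInfty_iff.mp hH0) (ε₀ / 2) (by positivity)
        exact (atImInfty_mem _).mpr ⟨A₀, hA₀⟩
      obtain ⟨z, hz1, hz2⟩ := (hlow.and hsmall).exists
      have hE : 1 ≤ Real.exp (-2 * π * (2 * ρ) * z.im) := by
        rw [Real.one_le_exp_iff]
        have h1 : 0 ≤ (-ρ) * z.im := mul_nonneg (by linarith) z.im_pos.le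
        have : -2 * π * (2 * ρ) * z.im = 4 * π * ((-ρ) * z.im) := by ring
        rw [this]
        positivity
      have : ε₀ ≤ ‖slashSq k H g z‖ := le_trans (by nlinarith) hz1
      linarith
    refine ⟨n, hρ, ?_⟩
    rw [Asymptotics.isBigO_iff]
    refine ⟨(2 * ‖φ 0‖) ^ 2 * β₂, ?_⟩
    filter_upwards [hup] with z hz
    rwa [Real.norm_of_nonneg (Real.exp_pos _).le]

end Literature.NumberTheory.EllipticCurves.ModularForms

end
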